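import Literature.Geometry.Lorentzian.CoordTensorCalculus
import Mathlib.Analysis.Matrix.Order
import HarnessLib

/-!
# Components of a tensor are bounded by its invariant norm (uniformly elliptic metrics)

A bridge over the rank-generic coordinate tensor calculus (`CoordTensorCalculus.lean`) between
INVARIANT tensor norms `|T|²_g = Σ_{I,J} (Π_a g^{I_a J_a}) T_I T_J` (`tnormSq`, the quantity of the
Bernstein–Shi estimates, Topping 2006, Thm. 3.3.1) and COMPONENT bounds `|T_I| ≤ C` (the
quantity of the coordinate bounds (5.3.3)–(5.3.4) in the proof of Thm. 5.3.1, p. 47):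

* `MetricCoord.slotProd g s` — the matrix `(I, J) ↦ Π_{a ∈ s} g (I a) (J a)` on the index set `α → ι`
  (an iterated Hadamard product of pulled-back copies of `g`); `posSemidef_slotProd` (Schur
  product theorem, Mathlib's `Matrix.PosSemidef.hadamard`);
  **`sub_smul_posSemidef_slotProd`** — if `g − μ·1` and `g` are positive semidefinite, `μ ≥ 0`,
  then `slotProd g s − μ^{|s|} · slotProd 1 s` is positive semidefinite; hence the quadratic-form
  inequality **`pow_mul_sum_sq_le_sum_prod`**:
  `μ^{|α|} Σ_I u_I² ≤ Σ_{I,J} (Π_a g_{I_a J_a}) u_I u_J`.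
* `MetricCoord.sum_ginv_mul_mul_ge` — for metric components `G` with `|G_x(v,w)| ≤ ‖G_x‖|v||w|`
  and `G_x` positive definite, the inverse matrix satisfies
  `Σ_{kl} g^{kl} v_k v_l ≥ (‖G_x‖ Σ_k |b_k|²)⁻¹ Σ_k v_k²` (Cauchy–Schwarz twice);
* **`MetricCoord.sq_le_mul_tnormSq`** — `μ^{|α|} (T_x I)² ≤ |T|²_g(x)` with that `μ`: every component
  is bounded by the invariant norm times a power of `‖G_x‖ Σ|b_k|²`.

Everything is proved; no definition of `Prop` type.

## References

* P. Topping, *Lectures on the Ricci flow*, LMS Lecture Note Series 325, CUP 2006, §2.1 (the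
  norm `|T|²`), Thm. 3.3.1 and §5.3, p. 47. [Topping2006]
* I. Schur, *Bemerkungen zur Theorie der beschränkten Bilinearformen mit unendlich vielen
  Veränderlichen*, J. reine angew. Math. 140 (1911), 1–28 (the Schur product theorem; in Mathlib as
  `Matrix.PosSemidef.hadamard`).
-/

noncomputable section

open Set Finset Module Function
open scoped Matrix

/-! ### Iterated Hadamard products of a positive semidefinite matrix -/

namespace Literature.Geometry.Lorentzian

namespace MetricCoord

open Matrix

section SlotProd

variable {ι : Type*} {α : Type*}

/-- The matrix `(I, J) ↦ Π_{a ∈ s} g (I a) (J a)` on the index set `α → ι`: the Hadamard product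
over `a ∈ s` of the copies of `g` pulled back along `I ↦ I a`. [folklore] -/
def slotProd (g : Matrix ι ι ℝ) (s : Finset α) : Matrix (α → ι) (α → ι) ℝ :=
  Matrix.of fun I J ↦ ∏ a ∈ s, g (I a) (J a)

/-- Unfolding lemma for `slotProd`. [folklore] -/
@[simp] theorem slotProd_apply (g : Matrix ι ι ℝ) (s : Finset α) (I J : α → ι) :
    slotProd g s I J = ∏ a ∈ s, g (I a) (J a) := rfl

/-- The empty product is the all-ones matrix. [folklore] -/
theorem slotProd_empty (g : Matrix ι ι ℝ) :
    slotProd g (∅ : Finset α) = vecMulVec (star (1 : (α → ι) → ℝ)) 1 := by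
  ext I J
  simp [vecMulVec_apply]

/-- Inserting a slot multiplies (Hadamard) by the pulled-back copy of `g`. [folklore] -/
theorem slotProd_insert [DecidableEq α] (g : Matrix ι ι ℝ) {a : α} {s : Finset α} (ha : a ∉ s) :
    slotProd g (insert a s) = slotProd g s ⊙ g.submatrix (fun I : α → ι ↦ I a) (fun I : α → ι ↦ I a) := by
  ext I J
  simp [Finset.prod_insert ha, hadamard_apply, mul_comm]

/-- `slotProd` of the identity matrix: the indicator of `I = J on s`. [folklore] -/
theorem slotProd_one_apply [DecidableEq ι] (s : Finset α) (I J : α → ι) :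
    slotProd (1 : Matrix ι ι ℝ) s I J = if ∀ a ∈ s, I a = J a then 1 else 0 := by
  rw [slotProd_apply]
  simp only [Matrix.one_apply]
  exact Finset.prod_boole

/-- Scalars pass through `slotProd` as powers. [folklore] -/
theorem slotProd_smul_one [DecidableEq ι] (μ : ℝ) (s : Finset α) :
    slotProd (μ • (1 : Matrix ι ι ℝ)) s = μ ^ s.card • slotProd (1 : Matrix ι ι ℝ) s := by
  ext I J
  simp only [slotProd_apply, Matrix.smul_apply, smul_eq_mul, Finset.prod_mul_distrib,
    Finset.prod_const]

/-- **Schur product theorem, iterated**: `slotProd g s` is positive semidefinite when `g` is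
(Mathlib's `Matrix.PosSemidef.hadamard`). [folklore] -/
theorem posSemidef_slotProd [Fintype ι] [Fintype α] [DecidableEq α] {g : Matrix ι ι ℝ}
    (hg : g.PosSemidef) (s : Finset α) : (slotProd g s).PosSemidef := by
  induction s using Finset.induction_on with
  | empty =>
    rw [slotProd_empty]
    exact posSemidef_vecMulVec_star_self _
  | insert a s ha ih =>
    rw [slotProd_insert g ha]
    exact ih.hadamard (hg.submatrix _)

/-- Monotonicity of the Hadamard product in the positive semidefinite order:
`B ≤ A`, `D ≤ C`, `0 ≤ B`, `0 ≤ C` give `B ⊙ D ≤ A ⊙ C`. [folklore] -/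
theorem posSemidef_hadamard_sub_hadamard {κ : Type*} [Fintype κ] {A B C D : Matrix κ κ ℝ}
    (hAB : (A - B).PosSemidef) (hCD : (C - D).PosSemidef) (hB : B.PosSemidef) (hC : C.PosSemidef) :
    (A ⊙ C - B ⊙ D).PosSemidef := by
  have h : A ⊙ C - B ⊙ D = (A - B) ⊙ C + B ⊙ (C - D) := by
    ext i j
    simp only [Matrix.sub_apply, Matrix.add_apply, hadamard_apply]
    ring
  rw [h]
  exact (hAB.hadamard hC).add (hB.hadamard hCD)

/-- **The iterated Hadamard product dominates `μ^{|s|}` times the indicator**: if `g − μ·1` and `g`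
are positive semidefinite and `μ ≥ 0` then `slotProd g s − μ^{|s|} slotProd 1 s` is positive
semidefinite. [folklore] -/
theorem sub_smul_posSemidef_slotProd [Fintype ι] [DecidableEq ι] [Fintype α] [DecidableEq α]
    {g : Matrix ι ι ℝ} {μ : ℝ} (hμ : 0 ≤ μ) (hg : g.PosSemidef)
    (hgμ : (g - μ • (1 : Matrix ι ι ℝ)).PosSemidef) (s : Finset α) :
    (slotProd g s - μ ^ s.card • slotProd (1 : Matrix ι ι ℝ) s).PosSemidef := by
  induction s using Finset.induction_on with
  | empty =>
    simp only [Finset.card_empty, pow_zero, one_smul, slotProd_empty, sub_self]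
    exact PosSemidef.zero
  | insert a s ha ih =>
    have hone : (slotProd (1 : Matrix ι ι ℝ) s).PosSemidef := posSemidef_slotProd PosSemidef.one s
    have h1 : μ ^ (insert a s).card • slotProd (1 : Matrix ι ι ℝ) (insert a s) =
        (μ ^ s.card • slotProd (1 : Matrix ι ι ℝ) s) ⊙
          (μ • (1 : Matrix ι ι ℝ)).submatrix (fun I : α → ι ↦ I a) (fun I : α → ι ↦ I a) := by
      rw [Finset.card_insert_of_notMem ha, slotProd_insert _ ha]
      ext I J
      simp only [Matrix.smul_apply, hadamard_apply, submatrix_apply, smul_eq_mul, pow_succ]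
      ring
    rw [slotProd_insert g ha, h1]
    refine posSemidef_hadamard_sub_hadamard ih ?_ ?_ (hg.submatrix _)
    · have h2 : g.submatrix (fun I : α → ι ↦ I a) (fun I : α → ι ↦ I a)
          - (μ • (1 : Matrix ι ι ℝ)).submatrix (fun I : α → ι ↦ I a) (fun I : α → ι ↦ I a)
          = (g - μ • (1 : Matrix ι ι ℝ)).submatrix (fun I : α → ι ↦ I a) (fun I : α → ι ↦ I a) := by
        ext I J
        rfl
      rw [h2]
      exact hgμ.submatrix _
    · exact hone.smul (pow_nonneg hμ _)

/-- A real symmetric matrix with nonnegative quadratic form is positive semidefinite. [folklore] -/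
theorem posSemidef_of_forall_sum_nonneg [Fintype ι] {A : Matrix ι ι ℝ} (hsymm : ∀ i j, A i j = A j i)
    (h : ∀ v : ι → ℝ, 0 ≤ ∑ i, ∑ j, A i j * v i * v j) : A.PosSemidef := by
  refine PosSemidef.of_dotProduct_mulVec_nonneg ?_ fun v ↦ ?_
  · exact Matrix.IsHermitian.ext fun i j ↦ by simpa using hsymm j i
  · have heq : star v ⬝ᵥ (A *ᵥ v) = ∑ i, ∑ j, A i j * v i * v j := by
      simp only [dotProduct, mulVec, star_trivial, Finset.mul_sum]
      exact Finset.sum_congr rfl fun i _ ↦ Finset.sum_congr rfl fun j _ ↦ by ring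
    rw [heq]
    exact h v

/-- **The Kronecker-power lower bound**: if `Σ_{kl} g_{kl} v_k v_l ≥ μ Σ_k v_k²` for all `v`
(`g` symmetric, `μ ≥ 0`) then for every `u : (α → ι) → ℝ`,
`μ^{|α|} Σ_I u_I² ≤ Σ_{I,J} (Π_a g_{I_a J_a}) u_I u_J`. [folklore] -/
theorem pow_mul_sum_sq_le_sum_prod [Fintype ι] [DecidableEq ι] [Fintype α] [DecidableEq α]
    {g : Matrix ι ι ℝ} (hsymm : ∀ i j, g i j = g j i)
    {μ : ℝ} (hμ : 0 ≤ μ) (hg : ∀ v : ι → ℝ, μ * ∑ k, v k ^ 2 ≤ ∑ k, ∑ l, g k l * v k * v l)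
    (u : (α → ι) → ℝ) :
    μ ^ Fintype.card α * ∑ I, u I ^ 2 ≤ ∑ I, ∑ J, (∏ a, g (I a) (J a)) * (u I * u J) := by
  classical
  -- `g` and `g − μ·1` are positive semidefinite
  have hgμ : (g - μ • (1 : Matrix ι ι ℝ)).PosSemidef := by
    refine posSemidef_of_forall_sum_nonneg (fun i j ↦ ?_) fun v ↦ ?_
    · simp only [Matrix.sub_apply, Matrix.smul_apply, Matrix.one_apply, hsymm i j, eq_comm (a := i)]
    · have heq : ∑ i, ∑ j, (g - μ • (1 : Matrix ι ι ℝ)) i j * v i * v j =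
          ∑ k, ∑ l, g k l * v k * v l - μ * ∑ k, v k ^ 2 := by
        simp only [Matrix.sub_apply, Matrix.smul_apply, Matrix.one_apply, smul_eq_mul, mul_ite, mul_one, mul_zero,
          sub_mul, Finset.sum_sub_distrib, ite_mul, zero_mul, Finset.sum_ite_eq, Finset.mem_univ,
          if_true, Finset.mul_sum]
        congr 1
        exact Finset.sum_congr rfl fun k _ ↦ by ring
      rw [heq]
      linarith [hg v]
  have hg0 : g.PosSemidef := by
    refine posSemidef_of_forall_sum_nonneg hsymm fun v ↦ (le_trans ?_ (hg v))
    exact mul_nonneg hμ (Finset.sum_nonneg fun k _ ↦ sq_nonneg _)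
  -- the quadratic form of `slotProd g univ − μ^{|α|} slotProd 1 univ` at `u`
  have key := (sub_smul_posSemidef_slotProd hμ hg0 hgμ (Finset.univ : Finset α)).dotProduct_mulVec_nonneg u
  rw [Finset.card_univ] at key
  have hP : star u ⬝ᵥ (slotProd g Finset.univ *ᵥ u) = ∑ I, ∑ J, (∏ a, g (I a) (J a)) * (u I * u J) := by
    simp only [dotProduct, mulVec, star_trivial, Finset.mul_sum, slotProd_apply]
    exact Finset.sum_congr rfl fun I _ ↦ Finset.sum_congr rfl fun J _ ↦ by ring
  have hD : star u ⬝ᵥ (slotProd (1 : Matrix ι ι ℝ) Finset.univ *ᵥ u) = ∑ I, u I ^ 2 := by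
    simp only [dotProduct, mulVec, star_trivial]
    refine Finset.sum_congr rfl fun I _ ↦ ?_
    have h1 : ∑ J, slotProd (1 : Matrix ι ι ℝ) Finset.univ I J * u J = u I := by
      rw [Finset.sum_eq_single I]
      · rw [slotProd_one_apply, if_pos (fun a _ ↦ rfl), one_mul]
      · intro J _ hJ
        rw [slotProd_one_apply, if_neg, zero_mul]
        exact fun h ↦ hJ (funext fun a ↦ (h a (Finset.mem_univ a)).symm)
      · exact fun h ↦ absurd (Finset.mem_univ I) h
    rw [h1, sq]
  have hexp : star u ⬝ᵥ ((slotProd g Finset.univ - μ ^ Fintype.card α •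
      slotProd (1 : Matrix ι ι ℝ) Finset.univ) *ᵥ u) =
      ∑ I, ∑ J, (∏ a, g (I a) (J a)) * (u I * u J) - μ ^ Fintype.card α * ∑ I, u I ^ 2 := by
    rw [Matrix.sub_mulVec, dotProduct_sub, Matrix.smul_mulVec, dotProduct_smul, hP, hD,
      smul_eq_mul]
  rw [hexp] at key
  linarith

end SlotProd

/-! ### The inverse metric in a basis is uniformly elliptic; components versus `|T|²` -/

variable {E : Type*} [NormedAddCommGroup E] [NormedSpace ℝ E] [FiniteDimensional ℝ E]
  {ι : Type*} [Fintype ι] {G : E → E →L[ℝ] E →L[ℝ] ℝ} (b : Basis ι ℝ E) {x : E}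

omit [FiniteDimensional ℝ E] [Fintype ι] in
/-- **Cauchy–Schwarz for a positive semidefinite symmetric form**: `A(v,w)² ≤ A(v,v) A(w,w)`.
[folklore] -/
theorem sq_apply_le_mul_of_nonneg (A : E →L[ℝ] E →L[ℝ] ℝ) (hsymm : ∀ v w, A v w = A w v)
    (hpos : ∀ v, 0 ≤ A v v) (v w : E) : A v w ^ 2 ≤ A v v * A w w := by
  -- the discriminant of `t ↦ A(v + t w, v + t w) ≥ 0`
  have hquad : ∀ t : ℝ, 0 ≤ A w w * t ^ 2 + 2 * A v w * t + A v v := by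
    intro t
    have h := hpos (v + t • w)
    have heq : A (v + t • w) (v + t • w) = A w w * t ^ 2 + 2 * A v w * t + A v v := by
      simp only [map_add, map_smul, _root_.add_apply, FunLike.coe_smul, Pi.smul_apply, smul_eq_mul,
        hsymm w v]
      ring
    linarith [heq ▸ h]
  by_cases hw : A w w = 0
  · -- then `A v w = 0`
    have hvw : A v w = 0 := by
      by_contra hne
      have h := hquad (-(A v v + 1) / (2 * A v w))
      rw [hw] at h
      have : 2 * A v w * (-(A v v + 1) / (2 * A v w)) = -(A v v + 1) := by field_simp
      linarith
    rw [hvw, hw]; simp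
  · have hwpos : 0 < A w w := lt_of_le_of_ne (hpos w) (Ne.symm hw)
    have h := hquad (-(A v w) / A w w)
    have heq : A w w * (-(A v w) / A w w) ^ 2 + 2 * A v w * (-(A v w) / A w w) + A v v =
        (A v v * A w w - A v w ^ 2) / A w w := by
      field_simp
      ring
    rw [heq] at h
    have := (div_nonneg_iff.1 h).resolve_right (fun h' ↦ absurd h'.2 (not_le.2 hwpos))
    linarith [this.1]

/-- **The inverse metric in a basis is uniformly elliptic**: for `G_x` symmetric, invertible and
positive semidefinite, `Σ_{kl} g^{kl} v_k v_l ≥ (‖G_x‖ Σ_k |b_k|²)⁻¹ Σ_k v_k²` — with the covector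
`θ = Σ_k v_k bᵏ` and the vector `X = Σ_k v_k b_k`: `Σ g^{kl} v_k v_l = G(♯θ, ♯θ)`,
`(Σ v_k²)² = θ(X)² = G(♯θ, X)² ≤ G(♯θ,♯θ) G(X,X)` and `G(X,X) ≤ ‖G‖ |X|² ≤ ‖G‖ (Σ v_k²)(Σ |b_k|²)`.
[folklore] -/
theorem sum_ginv_mul_mul_ge (hi : (G x).IsInvertible) (hsymm : ∀ v w, G x v w = G x w v)
    (hpos : ∀ v, 0 ≤ G x v v) (v : ι → ℝ) :
    (‖G x‖ * ∑ k, ‖b k‖ ^ 2)⁻¹ * ∑ k, v k ^ 2 ≤ ∑ k, ∑ l, ginv G b x k l * v k * v l := by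
  classical
  set θ : E →L[ℝ] ℝ := ∑ k, v k • coordCLM b k with hθ
  set X : E := ∑ k, v k • b k with hX
  -- `Σ g^{kl} v_k v_l = θ(♯θ)`
  have hform : ∑ k, ∑ l, ginv G b x k l * v k * v l = θ (sharpAt G x θ) := by
    simp only [hθ, _root_.sum_apply, FunLike.coe_smul, Pi.smul_apply, smul_eq_mul, map_sum, map_smul,
      coordCLM_apply]
    refine Finset.sum_congr rfl fun k _ ↦ ?_
    rw [Finset.mul_sum]
    refine Finset.sum_congr rfl fun l _ ↦ ?_
    have hkl := ginv_comm b hi hsymm k l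
    simp only [ginv] at hkl ⊢
    rw [hkl]
    ring
  -- `θ(♯θ) = G(♯θ, ♯θ)` and `θ(X) = Σ v_k²`
  have happly : ∀ w, G x (sharpAt G x θ) w = θ w := fun w ↦ by rw [apply_sharpAt hi]
  have hθX : θ X = ∑ k, v k ^ 2 := by
    simp only [hθ, hX, _root_.sum_apply, FunLike.coe_smul, Pi.smul_apply, smul_eq_mul, map_sum,
      map_smul, coordCLM_apply, Module.Basis.coord_apply, Module.Basis.repr_self,
      Finsupp.single_apply]
    refine Finset.sum_congr rfl fun k _ ↦ ?_
    rw [Finset.sum_eq_single k (fun l _ hl ↦ by simp [Ne.symm hl]) (by simp)]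
    simp [sq]
  have hsq : (∑ k, v k ^ 2) ^ 2 ≤ θ (sharpAt G x θ) * G x X X := by
    have h := sq_apply_le_mul_of_nonneg (G x) hsymm hpos (sharpAt G x θ) X
    rwa [happly X, hθX, happly] at h
  -- `G(X,X) ≤ ‖G‖ (Σ v²)(Σ |b|²)`
  have hS0 : 0 ≤ ∑ k, v k ^ 2 := Finset.sum_nonneg fun k _ ↦ sq_nonneg _
  have hXX : G x X X ≤ ‖G x‖ * ((∑ k, v k ^ 2) * ∑ k, ‖b k‖ ^ 2) := by
    have h1 : G x X X ≤ ‖G x‖ * ‖X‖ * ‖X‖ := by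
      have := (G x).le_opNorm₂ X X
      rw [Real.norm_eq_abs] at this
      exact (le_abs_self _).trans this
    have h2 : ‖X‖ ≤ ∑ k, |v k| * ‖b k‖ := by
      refine (norm_sum_le _ _).trans (Finset.sum_le_sum fun k _ ↦ ?_)
      rw [norm_smul, Real.norm_eq_abs]
    have h3 : (∑ k, |v k| * ‖b k‖) ^ 2 ≤ (∑ k, |v k| ^ 2) * ∑ k, ‖b k‖ ^ 2 :=
      Finset.sum_mul_sq_le_sq_mul_sq _ _ _
    have h4 : (∑ k, |v k| ^ 2) = ∑ k, v k ^ 2 := Finset.sum_congr rfl fun k _ ↦ sq_abs _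
    have h5 : ‖X‖ * ‖X‖ ≤ (∑ k, v k ^ 2) * ∑ k, ‖b k‖ ^ 2 := by
      rw [← h4, ← sq]
      exact (pow_le_pow_left₀ (norm_nonneg _) h2 2).trans h3
    calc G x X X ≤ ‖G x‖ * ‖X‖ * ‖X‖ := h1
      _ = ‖G x‖ * (‖X‖ * ‖X‖) := by ring
      _ ≤ ‖G x‖ * ((∑ k, v k ^ 2) * ∑ k, ‖b k‖ ^ 2) :=
          mul_le_mul_of_nonneg_left h5 (norm_nonneg (G x))
  rw [hform]
  -- conclude
  by_cases hS : ∑ k, v k ^ 2 = 0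
  · rw [hS, mul_zero, ← happly]
    exact hpos _
  have hSpos : 0 < ∑ k, v k ^ 2 := lt_of_le_of_ne hS0 (Ne.symm hS)
  have hden_pos : 0 < ‖G x‖ * ∑ k, ‖b k‖ ^ 2 := by
    -- `G(X,X) > 0`-free argument: from `hsq`, `hXX` and `(Σ v²)² > 0`
    have h1 : 0 < (∑ k, v k ^ 2) ^ 2 := by positivity
    have h2 : 0 < θ (sharpAt G x θ) * G x X X := h1.trans_le hsq
    have h3 : 0 < G x X X := by
      rcases (mul_pos_iff.1 h2) with ⟨-, h⟩ | ⟨h, -⟩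
      · exact h
      · exact absurd h (not_lt.2 (by rw [← happly]; exact hpos _))
    have h4 : 0 < ‖G x‖ * ((∑ k, v k ^ 2) * ∑ k, ‖b k‖ ^ 2) := h3.trans_le hXX
    have h5 : 0 < (∑ k, v k ^ 2) * (‖G x‖ * ∑ k, ‖b k‖ ^ 2) := by linarith [h4]
    exact (mul_pos_iff_of_pos_left hSpos).1 h5 |> fun h ↦ h
  rw [inv_mul_le_iff₀ hden_pos]
  -- `(Σ v²) · 1 ≤ … `: multiply `hsq` through
  have h6 : (∑ k, v k ^ 2) ^ 2 ≤ θ (sharpAt G x θ) * (‖G x‖ * ((∑ k, v k ^ 2) * ∑ k, ‖b k‖ ^ 2)) :=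
    hsq.trans (mul_le_mul_of_nonneg_left hXX (by rw [← happly]; exact hpos _))
  have h7 : (∑ k, v k ^ 2) * (∑ k, v k ^ 2) ≤
      (∑ k, v k ^ 2) * ((‖G x‖ * ∑ k, ‖b k‖ ^ 2) * θ (sharpAt G x θ)) := by
    rw [← sq]
    refine h6.trans (le_of_eq ?_)
    ring
  exact le_of_mul_le_mul_left h7 hSpos

/-- **Components are bounded by the invariant norm** (uniformly elliptic metrics): with
`μ = (‖G_x‖ Σ_k |b_k|²)⁻¹`, every component of a tensor `T` of index type `α` satisfies
`μ^{|α|} (T_x I)² ≤ |T|²_g(x)` (`tnormSq`). Used to turn the invariant bounds of Shi's estimates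
into the component bounds of Topping's (5.3.3)–(5.3.4). [cite: Topping2006, §2.1 and §5.3, p. 47] -/
theorem sq_le_mul_tnormSq {α : Type*} [Fintype α] [DecidableEq α] (hi : (G x).IsInvertible)
    (hsymm : ∀ v w, G x v w = G x w v) (hpos : ∀ v, 0 ≤ G x v v) (T : E → (α → ι) → ℝ)
    (I : α → ι) :
    ((‖G x‖ * ∑ k, ‖b k‖ ^ 2)⁻¹) ^ Fintype.card α * T x I ^ 2 ≤ tnormSq G b T x := by
  classical
  have hμ : 0 ≤ (‖G x‖ * ∑ k, ‖b k‖ ^ 2)⁻¹ :=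
    inv_nonneg.2 (mul_nonneg (norm_nonneg (G x)) (Finset.sum_nonneg fun k _ ↦ sq_nonneg _))
  have hgs : ∀ i j, ginv G b x i j = ginv G b x j i := fun i j ↦ ginv_comm b hi hsymm i j
  have key := pow_mul_sum_sq_le_sum_prod (g := Matrix.of fun i j ↦ ginv G b x i j)
    (α := α) (fun i j ↦ hgs i j) hμ (fun v ↦ sum_ginv_mul_mul_ge b hi hsymm hpos v) (T x)
  rw [tnormSq_eq, tinner_apply]
  refine le_trans ?_ key
  refine mul_le_mul_of_nonneg_left ?_ (pow_nonneg hμ _)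
  exact Finset.single_le_sum (f := fun J ↦ T x J ^ 2) (fun J _ ↦ sq_nonneg _) (Finset.mem_univ I)

end MetricCoord

end Literature.Geometry.Lorentzian

end
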